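import Summits.HodgeConjecture.HodgeConjecture.Theorems.F0LD1ThetaGermDefs
import Summits.HodgeConjecture.HodgeConjecture.Theorems.F0LD1ArchTorusHom
import Summits.HodgeConjecture.HodgeConjecture.Theorems.F0LD2ThetaTensorClasses
import Summits.HodgeConjecture.HodgeConjecture.Theorems.F0LD2FrameTransportPin
import HarnessLib

-- SPLIT NOTE (LD1-p01 g3): this module = §2 (the four brick `def`s, statement-only) of LD1-plan (g2)'s junction v4 bc7f7ecada6a5bf4;
-- §1 + §3 (the sorry-free junction theorems) live in `Theorems.F0LD1ThetaSliceOfBricks`, which imports this file. The namespace is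
-- `…Cruxes.HLiu418.F0LD1ThetaSliceOfBricks` in BOTH modules so every announced constant keeps its fully-qualified name (gate: proof files ≤ 400 lines).
-- The four `def` BODIES are byte-identical to v4 (= v3 589c23d6); only their docstrings lost the `cite` TAGS (organ defs are route-posited bricks,
-- not published facts — a tagged `def : Prop` under Summits is relocated to Literature by the gate; ★ `F0LD1ThetaGermDefs` convention).

-- statements over the theta-kernel datum elaborate to very large types; elaborate sequentially (as in the ★ kit lineage)
set_option Elab.async false

/-!
# Crux `HLiu418`, line LD1 — organ (Gβ) `ThetaSlice₂` FROM FOUR BRICKS (junction sketch v4, LD1-plan (g2))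

SUB-ORGAN DEFS of (Gβ), each quantified over LITERALLY the binder list of ★ `F0LD1ThetaGermDefs.ThetaSlice₂` (rank 2; PINNED transport
`ιA k = (toAdeleGL g)⁻¹ · k · toAdeleGL g`; the kit pair `hT` and `CompactSpace [U(H)]` are DERIVED in the body, ★ `F0LD2FrameTransportPin` ∕ ★
`compactSpace_adelicGroupData_automorphicQuotient`), in the class currency
`[θ^{μ_W}_Ψ] := MemLp.toLp _ (memLp_toQuotFun_lineThetaLift L 2 H e₁ dV hdV hdV0 ιA hT lam hlam a' hρ μW Ψ (charCM ξ) μ 2)`, pure tensors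
`E(φ ⊗ Φ_f) := piSchwartzBruhatEquiv L⁺ (Fin n') (φ ⊗ₜ Φ_f)`, Hermite functions `h_β := follandHermite (frameV …) β` (the tokens of ★ `F0LD2ThetaTensorCLM`,
★ `F0LD1ThetaClassHermiteSum`, ★ `F0LD1ThetaClassTorusExtraction` §4, ★ `F0LD1ThetaClassFinSliceFinite` §3):
* `HermiteSum` (Gβ-Σ; ★ p850775): every pure-tensor class is the `L²`-sum `Σ_β c_β [θ_{h_β ⊗ Φ_f}]`;
* `TorusProjector` (Gβ-P; ★ p850643 + ★ p850733 §4): for every Hermite index `β` ONE bounded `P_β` preserving closed invariant subspaces, extracting the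
  `β`-component of every pure-tensor class and fixing `[θ_{h_β ⊗ Φ_f}]`;
* `FiniteLevel` (Gβ-L; ★ p850713 + ★ p850702 + ★ p850736): for every finite datum `Φ_f⁰` a level set `S ∋ Φ_f⁰` and a bounded `A` preserving closed invariant
  subspaces, with `A [θ_{φ ⊗ Φ_f}] = [θ_{φ ⊗ Φ_f″}]`, `Φ_f″ ∈ S`, fixing the classes of level `S`, and `span {[θ^{μ_W}_{h_β ⊗ Φ_f}] : Φ_f ∈ S}` finite-dimensional
  for every theta datum `(hρ, μ_W)` and every `β`;
* `MeasureScaling` (Gβ-M; ★ `UnitaryDualPairThetaLiftInvariantMeasure` §0–§1): classes for two finite invariant measures on `[U(W)]` are proportional;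
and the sorry-free JUNCTION `thetaSlice₂_of_bricks : HermiteSum → TorusProjector → FiniteLevel → MeasureScaling → F0LD1ThetaGermDefs.ThetaSlice₂`
(generic half = ★-free linear algebra §1; general generators by the exact pure-tensor reduction ★ `exists_tensor_of_apply_toLp_lineThetaLift_ne_zero`).
HC_CM is proved only modulo the 7 printed citations (2 remaining: hLiu418 = stmt-HodgeConjecture-24832, h413 = stmt-HodgeConjecture-24833) until rung 0 closes; count-neutral.
-/

set_option autoImplicit false
set_option linter.dupNamespace false

noncomputable section

open NumberField NumberField.InfinitePlace MeasureTheory IsDedekindDomain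
open scoped Matrix Kronecker ComplexOrder ENNReal TensorProduct SchwartzMap InnerProductSpace ComplexConjugate Classical
open Literature.NumberTheory.Automorphic Literature.NumberTheory.Automorphic.UnitaryGroup
open Literature.NumberTheory.Automorphic.UnitaryGroup.CotangentForms (toQuotFun)
open Literature.NumberTheory.Automorphic.UnitaryCurveForms
open Literature.NumberTheory.Automorphic.Liu2021 Literature.NumberTheory.Automorphic.Liu2021.Def411WeilCarriers
open Literature.NumberTheory.Automorphic.Liu2021.Def411WeilCarriersDoubling
open Literature.NumberTheory.Automorphic.Liu2021.CinfThetaTorus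
open Literature.NumberTheory.GaloisRepresentations Literature.NumberTheory.Automorphic.IdeleClassGroup
open Literature.NumberTheory.GelbartRogawski1991 Literature.NumberTheory.GelbartRogawski1991.UnitaryDualPair
open Literature.NumberTheory.GelbartRogawski1991.UnitaryDualPair.WeilCoinv
open Literature.NumberTheory.GelbartRogawski1991.GRConstruction
open Literature.NumberTheory.Weil1964
open Literature.RepresentationTheory.Liu2021 Literature.RepresentationTheory.HarrisKudlaSweet1996
open Literature.RepresentationTheory.HeisenbergGroup Literature.Analysis.SegalBargmann
open Literature.RepresentationTheory.KonnoKonno2007 Literature.RepresentationTheory.KonnoKonno2007.RealDualPair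
open Literature.RepresentationTheory.CompactGroups
open Literature.NumberTheory.Rogawski1990
open Summit.HodgeConjecture.HodgeConjecture.Cruxes.HLiu418.F0LD1ThetaTransportKit
open Summit.HodgeConjecture.HodgeConjecture.Cruxes.HLiu418.F0LD2ThetaTensorClasses
open Summit.HodgeConjecture.HodgeConjecture.Cruxes.HLiu418.F0LD2FrameTransportPin
open Summit.HodgeConjecture.HodgeConjecture.Cruxes.HLiu418.F0LD1ThetaGermDefs

namespace Summit.HodgeConjecture.HodgeConjecture.Cruxes.HLiu418.F0LD1ThetaSliceOfBricks

/-! ## §2 The four SUB-ORGANS of (Gβ) over the `ThetaSlice₂` frames (rank 2, pinned transport)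

Every brick is quantified over LITERALLY the binder list of ★ `F0LD1ThetaGermDefs.ThetaSlice₂` (same order and types; the pin
`ιA k = (toAdeleGL g)⁻¹ · k · toAdeleGL g`, from which ★ `F0LD2FrameTransportPin` gives the finite-part and archimedean compatibilities the pens
need); in the body the kit's transport pair `hT := ⟨continuous_of_pin …, mem_range_toAdelic_of_pin …⟩` and `CompactSpace [U(H)]` (a definite
place exists since `[L:ℚ] ≥ 4`) are derived by `haveI`, so the kit tokens `memLp_toQuotFun_lineThetaLift … ιA hT …` elaborate with no extra binder.
Classes: `[θ_Ψ] := MemLp.toLp _ (memLp_toQuotFun_lineThetaLift L 2 H e₁ dV hdV hdV0 ιA hT lam hlam a' hρ μW Ψ (charCM ξ) μ 2)`; pure tensors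
`E(φ ⊗ Φ_f) := piSchwartzBruhatEquiv L⁺ (Fin n') (φ ⊗ₜ Φ_f)` (the currency of ★ `F0LD2ThetaTensorCLM` ∕ ★ `F0LD1ThetaClassHermiteSum` ∕ ★
`F0LD1ThetaClassTorusExtraction` §4); Hermite functions `h_β := follandHermite (frameV L e₁ dV hdV hdV0 (lineW …) …) β`,
`β : (Fin n' × {v ∕∕ v.IsReal}) →₀ ℕ`. -/

/-- **(Gβ-Σ) `HermiteSum`** — every pure-tensor theta class is the `L²`-convergent sum of its Hermite pure-tensor components:
`∃ c, HasSum (β ↦ c β • [θ_{h_β ⊗ Φ_f}]) [θ_{φ ⊗ Φ_f}]` (intended proof: ONE LINE from ★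
`F0LD1ThetaClassHermiteSum.hasSum_follandCoeff_smul_thetaClass_follandHermite` at the frame `frameV …`, `c β = hermiteCoeff β (…)`).
(locator, not a cited fact: Folland1989, §1.7 (1.81)) (locator, not a cited fact: Weil1964, Chap. III n° 41 Thm 6 p. 193) -/
def HermiteSum : Prop :=
  ∀ (L : Type) [Field L] [NumberField L] [IsCMField L] (ι : L →+* ℂ) (H : Matrix (Fin 2) (Fin 2) L)
      (dV : Fin 2 → L) (hdV : ∀ i, IsCMField.complexConj L (dV i) = dV i) (hdV0 : ∀ i, dV i ≠ 0)
      (t : L) (ht : t ≠ 0) (g : GL (Fin 2) L)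
      (hg : formCongr ((IsCMField.complexConj L : L ≃ₐ[↥(maximalRealSubfield L)] L) : L →+* L) g (t • H) = Matrix.diagonal dV),
      (∃ T : GL (Fin 2) ℂ, formCongr (starRingEnd ℂ) T ((Matrix.diagonal dV).map ι) = Matrix.diagonal ![(1 : ℂ), -1]) →
      ∀ (hdef : ∀ τ' : L →+* ℂ, InfinitePlace.mk τ' ≠ InfinitePlace.mk ι → ((Matrix.diagonal dV).map τ').PosDef)
        (hdeg : 4 ≤ Module.finrank ℚ L)
        (μ : Measure (adelicGroupData (↥(maximalRealSubfield L)) L (IsCMField.complexConj L) 2 H).automorphicQuotient)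
        [(adelicGroupData (↥(maximalRealSubfield L)) L (IsCMField.complexConj L) 2 H).IsAutomorphicMeasure μ]
        {n' : ℕ} (e₁ : Fin 2 × Fin 1 ≃ Fin n')
        (lam : Literature.NumberTheory.Automorphic.IdeleClassGroup L →ₜ* Circle) (hlam : IsConjugateSymplectic L lam), HasWeight L lam 1 →
      ∀ (ιA : (adelicGroupData (↥(maximalRealSubfield L)) L (IsCMField.complexConj L) 2 H).Adelic →*
          ↥(UnitaryGroup.adelic (↥(maximalRealSubfield L)) L (IsCMField.complexConj L) 2 (Matrix.diagonal dV)))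
        (hιA : ∀ k, ((ιA k : ↥(UnitaryGroup.adelic (↥(maximalRealSubfield L)) L (IsCMField.complexConj L) 2 (Matrix.diagonal dV))) :
              GL (Fin 2) (AdeleRing (𝓞 L) L)) =
            (toAdeleGL L g)⁻¹ * adelicVal (↥(maximalRealSubfield L)) L (IsCMField.complexConj L) 2 H k * toAdeleGL L g)
        [CompactSpace (↥(UnitaryGroup.adelic (↥(maximalRealSubfield L)) L (IsCMField.complexConj L) 2 (Matrix.diagonal dV)) ⧸
          (UnitaryGroup.toAdelic (↥(maximalRealSubfield L)) L (IsCMField.complexConj L) 2 (Matrix.diagonal dV)).range)]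
        (a' : (↥(maximalRealSubfield L))ˣ)
        (ξ : haveI := normal_range_toAdelic_JW L a'
          PontryaginDual (↥(UnitaryGroup.adelic (↥(maximalRealSubfield L)) L (IsCMField.complexConj L) 1 (JW (↥(maximalRealSubfield L)) L a')) ⧸ (UnitaryGroup.toAdelic (↥(maximalRealSubfield L)) L (IsCMField.complexConj L) 1 (JW (↥(maximalRealSubfield L)) L a')).range)),
        letI : MeasurableSpace (↥(UnitaryGroup.adelic (↥(maximalRealSubfield L)) L (IsCMField.complexConj L) 1 (JW (↥(maximalRealSubfield L)) L a')) ⧸ (UnitaryGroup.toAdelic (↥(maximalRealSubfield L)) L (IsCMField.complexConj L) 1 (JW (↥(maximalRealSubfield L)) L a')).range) := borel _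
        haveI := normal_range_toAdelic_JW L a'
        haveI : CompactSpace (adelicGroupData (↥(maximalRealSubfield L)) L (IsCMField.complexConj L) 2 H).automorphicQuotient :=
          (UnitaryGroup.exists_infinitePlace_ne L hdeg ι).elim fun τ hτ =>
            UnitaryGroup.compactSpace_adelicGroupData_automorphicQuotient L 2 H
              (UnitaryGroup.anisotropic_of_formCongr_smul_eq_of_posDef L 2 H dV t ht g hg τ (hdef τ hτ))
        haveI hT : Continuous ιA ∧ ∀ ⦃γ : (adelicGroupData (↥(maximalRealSubfield L)) L (IsCMField.complexConj L) 2 H).Adelic⦄,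
            γ ∈ (UnitaryGroup.toAdelic (↥(maximalRealSubfield L)) L (IsCMField.complexConj L) 2 H).range →
              ιA γ ∈ (UnitaryGroup.toAdelic (↥(maximalRealSubfield L)) L (IsCMField.complexConj L) 2 (Matrix.diagonal dV)).range :=
          ⟨continuous_of_pin L 2 H dV g ιA hιA, fun _ hγ => mem_range_toAdelic_of_pin L 2 H dV t ht g hg ιA hιA hγ⟩
        ∀ (hρ : HasThetaMajorants fun
          (p : ↥(UnitaryGroup.adelic (↥(maximalRealSubfield L)) L (IsCMField.complexConj L) 2 (Matrix.diagonal dV)) × ↥(UnitaryGroup.adelic (↥(maximalRealSubfield L)) L (IsCMField.complexConj L) 1 (JW (↥(maximalRealSubfield L)) L a'))) (Φ : piSchwartzBruhat (↥(maximalRealSubfield L)) (Fin n')) =>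
            pairRep (↥(maximalRealSubfield L)) L (IsCMField.complexConj L) 2 1 e₁ (Matrix.diagonal dV) (JW (↥(maximalRealSubfield L)) L a')
              (chiSplittingLine L e₁ dV hdV hdV0 (toHeckeCharacter L lam) (isUnitary_toHeckeCharacter L lam)
                ((isOscillatorChar_toHeckeCharacter_iff lam).mpr hlam) (TW (↥(maximalRealSubfield L)) a')
                (isUnit_det_TW (↥(maximalRealSubfield L)) a') (JW (↥(maximalRealSubfield L)) L a') (JW_eq (↥(maximalRealSubfield L)) L a'))
              p Φ)
        (μW : Measure (↥(UnitaryGroup.adelic (↥(maximalRealSubfield L)) L (IsCMField.complexConj L) 1 (JW (↥(maximalRealSubfield L)) L a')) ⧸ (UnitaryGroup.toAdelic (↥(maximalRealSubfield L)) L (IsCMField.complexConj L) 1 (JW (↥(maximalRealSubfield L)) L a')).range))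
        [IsFiniteMeasure μW] [SMulInvariantMeasure ↥(UnitaryGroup.adelic (↥(maximalRealSubfield L)) L (IsCMField.complexConj L) 1 (JW (↥(maximalRealSubfield L)) L a')) (↥(UnitaryGroup.adelic (↥(maximalRealSubfield L)) L (IsCMField.complexConj L) 1 (JW (↥(maximalRealSubfield L)) L a')) ⧸ (UnitaryGroup.toAdelic (↥(maximalRealSubfield L)) L (IsCMField.complexConj L) 1 (JW (↥(maximalRealSubfield L)) L a')).range) μW]
        (φ : 𝓢((Fin n' → mixedEmbedding.mixedSpace ↥(maximalRealSubfield L)), ℂ)) (Φf : FinSB (↥(maximalRealSubfield L)) (Fin n')),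
        ∃ c : ((Fin n' × {v : InfinitePlace (↥(maximalRealSubfield L)) // v.IsReal}) →₀ ℕ) → ℂ,
          HasSum (fun β => c β • MemLp.toLp _ (memLp_toQuotFun_lineThetaLift L 2 H e₁ dV hdV hdV0 ιA hT lam hlam a' hρ μW
            (piSchwartzBruhatEquiv (↥(maximalRealSubfield L)) (Fin n') (follandHermite (frameV L e₁ dV hdV hdV0 (lineW L (TW (Fp L) a')) (complexConj_lineW L (TW (Fp L) a'))
                (lineW_ne_zero L (TW (Fp L) a') (isUnit_det_TW (Fp L) a'))) β ⊗ₜ[ℂ] Φf)) (charCM ξ) μ 2))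
            (MemLp.toLp _ (memLp_toQuotFun_lineThetaLift L 2 H e₁ dV hdV hdV0 ιA hT lam hlam a' hρ μW
            (piSchwartzBruhatEquiv (↥(maximalRealSubfield L)) (Fin n') (φ ⊗ₜ[ℂ] Φf)) (charCM ξ) μ 2))

/-- **(Gβ-P) `TorusProjector`** — for every Hermite index `β` ONE bounded operator `P_β` on `L²([U(H)], μ)` (intended: the full archimedean diagonal-torus
character projector `Schur.charProjL μT κ_β ((rightRegular μ).restrict k)` of ★ `F0LD1ArchTorusHom` §1, type `κ_β` as in ★
`F0LD1ThetaClassTorusExtraction.charProjL_thetaClass_eq_coeff_smul_of_torusPin`) which (i) maps every closed `R`-invariant subspace into itself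
(`charProjL` is an integral of `R(k(z))`), (ii) sends every pure-tensor class `[θ_{φ ⊗ Φ_f}]` to a multiple of `[θ_{h_β ⊗ Φ_f}]` (★ TorusExtraction §4, class
currency, fed by (Gβ-Σ)'s ★ expansion), (iii) fixes `[θ_{h_β ⊗ Φ_f}]` (★ `charProj_thetaClass_follandHermite_eq_self_of_torusPin`).
(locator, not a cited fact: BrockerTomDieck1985, III (5.10); II (8.1)) (locator, not a cited fact: KonnoKonno2007, Thm. 5.4) (locator, not a cited fact: Folland1989, §1.7) -/
def TorusProjector : Prop :=
  ∀ (L : Type) [Field L] [NumberField L] [IsCMField L] (ι : L →+* ℂ) (H : Matrix (Fin 2) (Fin 2) L)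
      (dV : Fin 2 → L) (hdV : ∀ i, IsCMField.complexConj L (dV i) = dV i) (hdV0 : ∀ i, dV i ≠ 0)
      (t : L) (ht : t ≠ 0) (g : GL (Fin 2) L)
      (hg : formCongr ((IsCMField.complexConj L : L ≃ₐ[↥(maximalRealSubfield L)] L) : L →+* L) g (t • H) = Matrix.diagonal dV),
      (∃ T : GL (Fin 2) ℂ, formCongr (starRingEnd ℂ) T ((Matrix.diagonal dV).map ι) = Matrix.diagonal ![(1 : ℂ), -1]) →
      ∀ (hdef : ∀ τ' : L →+* ℂ, InfinitePlace.mk τ' ≠ InfinitePlace.mk ι → ((Matrix.diagonal dV).map τ').PosDef)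
        (hdeg : 4 ≤ Module.finrank ℚ L)
        (μ : Measure (adelicGroupData (↥(maximalRealSubfield L)) L (IsCMField.complexConj L) 2 H).automorphicQuotient)
        [(adelicGroupData (↥(maximalRealSubfield L)) L (IsCMField.complexConj L) 2 H).IsAutomorphicMeasure μ]
        {n' : ℕ} (e₁ : Fin 2 × Fin 1 ≃ Fin n')
        (lam : Literature.NumberTheory.Automorphic.IdeleClassGroup L →ₜ* Circle) (hlam : IsConjugateSymplectic L lam), HasWeight L lam 1 →
      ∀ (ιA : (adelicGroupData (↥(maximalRealSubfield L)) L (IsCMField.complexConj L) 2 H).Adelic →*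
          ↥(UnitaryGroup.adelic (↥(maximalRealSubfield L)) L (IsCMField.complexConj L) 2 (Matrix.diagonal dV)))
        (hιA : ∀ k, ((ιA k : ↥(UnitaryGroup.adelic (↥(maximalRealSubfield L)) L (IsCMField.complexConj L) 2 (Matrix.diagonal dV))) :
              GL (Fin 2) (AdeleRing (𝓞 L) L)) =
            (toAdeleGL L g)⁻¹ * adelicVal (↥(maximalRealSubfield L)) L (IsCMField.complexConj L) 2 H k * toAdeleGL L g)
        [CompactSpace (↥(UnitaryGroup.adelic (↥(maximalRealSubfield L)) L (IsCMField.complexConj L) 2 (Matrix.diagonal dV)) ⧸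
          (UnitaryGroup.toAdelic (↥(maximalRealSubfield L)) L (IsCMField.complexConj L) 2 (Matrix.diagonal dV)).range)]
        (a' : (↥(maximalRealSubfield L))ˣ)
        (ξ : haveI := normal_range_toAdelic_JW L a'
          PontryaginDual (↥(UnitaryGroup.adelic (↥(maximalRealSubfield L)) L (IsCMField.complexConj L) 1 (JW (↥(maximalRealSubfield L)) L a')) ⧸ (UnitaryGroup.toAdelic (↥(maximalRealSubfield L)) L (IsCMField.complexConj L) 1 (JW (↥(maximalRealSubfield L)) L a')).range)),
        letI : MeasurableSpace (↥(UnitaryGroup.adelic (↥(maximalRealSubfield L)) L (IsCMField.complexConj L) 1 (JW (↥(maximalRealSubfield L)) L a')) ⧸ (UnitaryGroup.toAdelic (↥(maximalRealSubfield L)) L (IsCMField.complexConj L) 1 (JW (↥(maximalRealSubfield L)) L a')).range) := borel _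
        haveI := normal_range_toAdelic_JW L a'
        haveI : CompactSpace (adelicGroupData (↥(maximalRealSubfield L)) L (IsCMField.complexConj L) 2 H).automorphicQuotient :=
          (UnitaryGroup.exists_infinitePlace_ne L hdeg ι).elim fun τ hτ =>
            UnitaryGroup.compactSpace_adelicGroupData_automorphicQuotient L 2 H
              (UnitaryGroup.anisotropic_of_formCongr_smul_eq_of_posDef L 2 H dV t ht g hg τ (hdef τ hτ))
        haveI hT : Continuous ιA ∧ ∀ ⦃γ : (adelicGroupData (↥(maximalRealSubfield L)) L (IsCMField.complexConj L) 2 H).Adelic⦄,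
            γ ∈ (UnitaryGroup.toAdelic (↥(maximalRealSubfield L)) L (IsCMField.complexConj L) 2 H).range →
              ιA γ ∈ (UnitaryGroup.toAdelic (↥(maximalRealSubfield L)) L (IsCMField.complexConj L) 2 (Matrix.diagonal dV)).range :=
          ⟨continuous_of_pin L 2 H dV g ιA hιA, fun _ hγ => mem_range_toAdelic_of_pin L 2 H dV t ht g hg ιA hιA hγ⟩
        ∀ (β : ((Fin n' × {v : InfinitePlace (↥(maximalRealSubfield L)) // v.IsReal}) →₀ ℕ)), ∃ P : ((adelicGroupData (↥(maximalRealSubfield L)) L (IsCMField.complexConj L) 2 H).L2 μ) →L[ℂ] ((adelicGroupData (↥(maximalRealSubfield L)) L (IsCMField.complexConj L) 2 H).L2 μ),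
          (∀ Q : ContRepresentation.ClosedSubrep ((adelicGroupData (↥(maximalRealSubfield L)) L (IsCMField.complexConj L) 2 H).rightRegular μ), ∀ v ∈ Q, P v ∈ Q) ∧
          (∀ (hρ : HasThetaMajorants fun
          (p : ↥(UnitaryGroup.adelic (↥(maximalRealSubfield L)) L (IsCMField.complexConj L) 2 (Matrix.diagonal dV)) × ↥(UnitaryGroup.adelic (↥(maximalRealSubfield L)) L (IsCMField.complexConj L) 1 (JW (↥(maximalRealSubfield L)) L a'))) (Φ : piSchwartzBruhat (↥(maximalRealSubfield L)) (Fin n')) =>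
            pairRep (↥(maximalRealSubfield L)) L (IsCMField.complexConj L) 2 1 e₁ (Matrix.diagonal dV) (JW (↥(maximalRealSubfield L)) L a')
              (chiSplittingLine L e₁ dV hdV hdV0 (toHeckeCharacter L lam) (isUnitary_toHeckeCharacter L lam)
                ((isOscillatorChar_toHeckeCharacter_iff lam).mpr hlam) (TW (↥(maximalRealSubfield L)) a')
                (isUnit_det_TW (↥(maximalRealSubfield L)) a') (JW (↥(maximalRealSubfield L)) L a') (JW_eq (↥(maximalRealSubfield L)) L a'))
              p Φ)
            (μW : Measure (↥(UnitaryGroup.adelic (↥(maximalRealSubfield L)) L (IsCMField.complexConj L) 1 (JW (↥(maximalRealSubfield L)) L a')) ⧸ (UnitaryGroup.toAdelic (↥(maximalRealSubfield L)) L (IsCMField.complexConj L) 1 (JW (↥(maximalRealSubfield L)) L a')).range))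
        [IsFiniteMeasure μW] [SMulInvariantMeasure ↥(UnitaryGroup.adelic (↥(maximalRealSubfield L)) L (IsCMField.complexConj L) 1 (JW (↥(maximalRealSubfield L)) L a')) (↥(UnitaryGroup.adelic (↥(maximalRealSubfield L)) L (IsCMField.complexConj L) 1 (JW (↥(maximalRealSubfield L)) L a')) ⧸ (UnitaryGroup.toAdelic (↥(maximalRealSubfield L)) L (IsCMField.complexConj L) 1 (JW (↥(maximalRealSubfield L)) L a')).range) μW]
            (φ : 𝓢((Fin n' → mixedEmbedding.mixedSpace ↥(maximalRealSubfield L)), ℂ)) (Φf : FinSB (↥(maximalRealSubfield L)) (Fin n')),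
            ∃ c : ℂ, P (MemLp.toLp _ (memLp_toQuotFun_lineThetaLift L 2 H e₁ dV hdV hdV0 ιA hT lam hlam a' hρ μW
            (piSchwartzBruhatEquiv (↥(maximalRealSubfield L)) (Fin n') (φ ⊗ₜ[ℂ] Φf)) (charCM ξ) μ 2)) =
              c • MemLp.toLp _ (memLp_toQuotFun_lineThetaLift L 2 H e₁ dV hdV hdV0 ιA hT lam hlam a' hρ μW
            (piSchwartzBruhatEquiv (↥(maximalRealSubfield L)) (Fin n') (follandHermite (frameV L e₁ dV hdV hdV0 (lineW L (TW (Fp L) a')) (complexConj_lineW L (TW (Fp L) a'))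
                (lineW_ne_zero L (TW (Fp L) a') (isUnit_det_TW (Fp L) a'))) β ⊗ₜ[ℂ] Φf)) (charCM ξ) μ 2)) ∧
          (∀ (hρ : HasThetaMajorants fun
          (p : ↥(UnitaryGroup.adelic (↥(maximalRealSubfield L)) L (IsCMField.complexConj L) 2 (Matrix.diagonal dV)) × ↥(UnitaryGroup.adelic (↥(maximalRealSubfield L)) L (IsCMField.complexConj L) 1 (JW (↥(maximalRealSubfield L)) L a'))) (Φ : piSchwartzBruhat (↥(maximalRealSubfield L)) (Fin n')) =>
            pairRep (↥(maximalRealSubfield L)) L (IsCMField.complexConj L) 2 1 e₁ (Matrix.diagonal dV) (JW (↥(maximalRealSubfield L)) L a')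
              (chiSplittingLine L e₁ dV hdV hdV0 (toHeckeCharacter L lam) (isUnitary_toHeckeCharacter L lam)
                ((isOscillatorChar_toHeckeCharacter_iff lam).mpr hlam) (TW (↥(maximalRealSubfield L)) a')
                (isUnit_det_TW (↥(maximalRealSubfield L)) a') (JW (↥(maximalRealSubfield L)) L a') (JW_eq (↥(maximalRealSubfield L)) L a'))
              p Φ)
            (μW : Measure (↥(UnitaryGroup.adelic (↥(maximalRealSubfield L)) L (IsCMField.complexConj L) 1 (JW (↥(maximalRealSubfield L)) L a')) ⧸ (UnitaryGroup.toAdelic (↥(maximalRealSubfield L)) L (IsCMField.complexConj L) 1 (JW (↥(maximalRealSubfield L)) L a')).range))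
        [IsFiniteMeasure μW] [SMulInvariantMeasure ↥(UnitaryGroup.adelic (↥(maximalRealSubfield L)) L (IsCMField.complexConj L) 1 (JW (↥(maximalRealSubfield L)) L a')) (↥(UnitaryGroup.adelic (↥(maximalRealSubfield L)) L (IsCMField.complexConj L) 1 (JW (↥(maximalRealSubfield L)) L a')) ⧸ (UnitaryGroup.toAdelic (↥(maximalRealSubfield L)) L (IsCMField.complexConj L) 1 (JW (↥(maximalRealSubfield L)) L a')).range) μW]
            (Φf : FinSB (↥(maximalRealSubfield L)) (Fin n')),
            P (MemLp.toLp _ (memLp_toQuotFun_lineThetaLift L 2 H e₁ dV hdV hdV0 ιA hT lam hlam a' hρ μW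
            (piSchwartzBruhatEquiv (↥(maximalRealSubfield L)) (Fin n') (follandHermite (frameV L e₁ dV hdV hdV0 (lineW L (TW (Fp L) a')) (complexConj_lineW L (TW (Fp L) a'))
                (lineW_ne_zero L (TW (Fp L) a') (isUnit_det_TW (Fp L) a'))) β ⊗ₜ[ℂ] Φf)) (charCM ξ) μ 2)) =
              MemLp.toLp _ (memLp_toQuotFun_lineThetaLift L 2 H e₁ dV hdV hdV0 ιA hT lam hlam a' hρ μW
            (piSchwartzBruhatEquiv (↥(maximalRealSubfield L)) (Fin n') (follandHermite (frameV L e₁ dV hdV hdV0 (lineW L (TW (Fp L) a')) (complexConj_lineW L (TW (Fp L) a'))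
                (lineW_ne_zero L (TW (Fp L) a') (isUnit_det_TW (Fp L) a'))) β ⊗ₜ[ℂ] Φf)) (charCM ξ) μ 2))

/-- **(Gβ-L) `FiniteLevel`** — every finite datum `Φ_f⁰` has a LEVEL: a set `S ∋ Φ_f⁰` of finite data and a bounded operator `A` on `L²([U(H)], μ)`
(intended: `S` = the data fixed by `ω_f(ι_V k, 1)`, `k ∈ K′`, for a compact open `K′ ≤ U(H)(𝔸_{L⁺,f})` fixing `Φ_f⁰` — ★
`F0LD1ThetaClassLevelExists`; `A` = the `K′`-average `∫_{K′} R(k) · dk` — ★ `F0LD1ThetaClassFiniteAverage`, ★ `ContRepresentation.vectorAverage`)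
with (i) `A` maps closed `R`-invariant subspaces into themselves; (ii) `A [θ_{φ ⊗ Φ_f}] = [θ_{φ ⊗ Φ_f″}]` for some `Φ_f″ ∈ S` (the finite coset
average of `Φ_f`, ★ `rightRegular_finAdelicToAdelic_toLp_lineThetaLift_tensor`); (iii) `A` fixes the classes of level `S`; (iv) for every theta
datum `(hρ, μ_W)` and every `β` the slice `span {[θ_{h_β ⊗ Φ_f′}] : Φ_f′ ∈ S}` is FINITE-DIMENSIONAL (★
`F0LD1ThetaClassFinSliceFinite.finiteDimensional_span_toLp_lineThetaLift_tmul_of_fixed`: local admissibility of the Weil representation at the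
finite places + ★ `finSBReindex` ∕ `piSBReindex_tmul` currency bridge). (locator, not a cited fact: BorelJacquet1979, §4.6) (locator, not a cited fact: Liu2021, Def. 4.11; proof of Prop. 4.13
Case 1) (locator, not a cited fact: MoeglinVignerasWaldspurger1987, Chap. 2 I.4 Exemple (1); Chap. 3 IV.4) (locator, not a cited fact: Rallis1984, proof of Thm. 1.2.2 p. 356) -/
def FiniteLevel : Prop :=
  ∀ (L : Type) [Field L] [NumberField L] [IsCMField L] (ι : L →+* ℂ) (H : Matrix (Fin 2) (Fin 2) L)
      (dV : Fin 2 → L) (hdV : ∀ i, IsCMField.complexConj L (dV i) = dV i) (hdV0 : ∀ i, dV i ≠ 0)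
      (t : L) (ht : t ≠ 0) (g : GL (Fin 2) L)
      (hg : formCongr ((IsCMField.complexConj L : L ≃ₐ[↥(maximalRealSubfield L)] L) : L →+* L) g (t • H) = Matrix.diagonal dV),
      (∃ T : GL (Fin 2) ℂ, formCongr (starRingEnd ℂ) T ((Matrix.diagonal dV).map ι) = Matrix.diagonal ![(1 : ℂ), -1]) →
      ∀ (hdef : ∀ τ' : L →+* ℂ, InfinitePlace.mk τ' ≠ InfinitePlace.mk ι → ((Matrix.diagonal dV).map τ').PosDef)
        (hdeg : 4 ≤ Module.finrank ℚ L)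
        (μ : Measure (adelicGroupData (↥(maximalRealSubfield L)) L (IsCMField.complexConj L) 2 H).automorphicQuotient)
        [(adelicGroupData (↥(maximalRealSubfield L)) L (IsCMField.complexConj L) 2 H).IsAutomorphicMeasure μ]
        {n' : ℕ} (e₁ : Fin 2 × Fin 1 ≃ Fin n')
        (lam : Literature.NumberTheory.Automorphic.IdeleClassGroup L →ₜ* Circle) (hlam : IsConjugateSymplectic L lam), HasWeight L lam 1 →
      ∀ (ιA : (adelicGroupData (↥(maximalRealSubfield L)) L (IsCMField.complexConj L) 2 H).Adelic →*
          ↥(UnitaryGroup.adelic (↥(maximalRealSubfield L)) L (IsCMField.complexConj L) 2 (Matrix.diagonal dV)))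
        (hιA : ∀ k, ((ιA k : ↥(UnitaryGroup.adelic (↥(maximalRealSubfield L)) L (IsCMField.complexConj L) 2 (Matrix.diagonal dV))) :
              GL (Fin 2) (AdeleRing (𝓞 L) L)) =
            (toAdeleGL L g)⁻¹ * adelicVal (↥(maximalRealSubfield L)) L (IsCMField.complexConj L) 2 H k * toAdeleGL L g)
        [CompactSpace (↥(UnitaryGroup.adelic (↥(maximalRealSubfield L)) L (IsCMField.complexConj L) 2 (Matrix.diagonal dV)) ⧸
          (UnitaryGroup.toAdelic (↥(maximalRealSubfield L)) L (IsCMField.complexConj L) 2 (Matrix.diagonal dV)).range)]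
        (a' : (↥(maximalRealSubfield L))ˣ)
        (ξ : haveI := normal_range_toAdelic_JW L a'
          PontryaginDual (↥(UnitaryGroup.adelic (↥(maximalRealSubfield L)) L (IsCMField.complexConj L) 1 (JW (↥(maximalRealSubfield L)) L a')) ⧸ (UnitaryGroup.toAdelic (↥(maximalRealSubfield L)) L (IsCMField.complexConj L) 1 (JW (↥(maximalRealSubfield L)) L a')).range)),
        letI : MeasurableSpace (↥(UnitaryGroup.adelic (↥(maximalRealSubfield L)) L (IsCMField.complexConj L) 1 (JW (↥(maximalRealSubfield L)) L a')) ⧸ (UnitaryGroup.toAdelic (↥(maximalRealSubfield L)) L (IsCMField.complexConj L) 1 (JW (↥(maximalRealSubfield L)) L a')).range) := borel _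
        haveI := normal_range_toAdelic_JW L a'
        haveI : CompactSpace (adelicGroupData (↥(maximalRealSubfield L)) L (IsCMField.complexConj L) 2 H).automorphicQuotient :=
          (UnitaryGroup.exists_infinitePlace_ne L hdeg ι).elim fun τ hτ =>
            UnitaryGroup.compactSpace_adelicGroupData_automorphicQuotient L 2 H
              (UnitaryGroup.anisotropic_of_formCongr_smul_eq_of_posDef L 2 H dV t ht g hg τ (hdef τ hτ))
        haveI hT : Continuous ιA ∧ ∀ ⦃γ : (adelicGroupData (↥(maximalRealSubfield L)) L (IsCMField.complexConj L) 2 H).Adelic⦄,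
            γ ∈ (UnitaryGroup.toAdelic (↥(maximalRealSubfield L)) L (IsCMField.complexConj L) 2 H).range →
              ιA γ ∈ (UnitaryGroup.toAdelic (↥(maximalRealSubfield L)) L (IsCMField.complexConj L) 2 (Matrix.diagonal dV)).range :=
          ⟨continuous_of_pin L 2 H dV g ιA hιA, fun _ hγ => mem_range_toAdelic_of_pin L 2 H dV t ht g hg ιA hιA hγ⟩
        ∀ (Φf₀ : FinSB (↥(maximalRealSubfield L)) (Fin n')), ∃ (S : Set (FinSB (↥(maximalRealSubfield L)) (Fin n'))) (A : ((adelicGroupData (↥(maximalRealSubfield L)) L (IsCMField.complexConj L) 2 H).L2 μ) →L[ℂ] ((adelicGroupData (↥(maximalRealSubfield L)) L (IsCMField.complexConj L) 2 H).L2 μ)), Φf₀ ∈ S ∧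
          (∀ Q : ContRepresentation.ClosedSubrep ((adelicGroupData (↥(maximalRealSubfield L)) L (IsCMField.complexConj L) 2 H).rightRegular μ), ∀ v ∈ Q, A v ∈ Q) ∧
          (∀ (hρ : HasThetaMajorants fun
          (p : ↥(UnitaryGroup.adelic (↥(maximalRealSubfield L)) L (IsCMField.complexConj L) 2 (Matrix.diagonal dV)) × ↥(UnitaryGroup.adelic (↥(maximalRealSubfield L)) L (IsCMField.complexConj L) 1 (JW (↥(maximalRealSubfield L)) L a'))) (Φ : piSchwartzBruhat (↥(maximalRealSubfield L)) (Fin n')) =>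
            pairRep (↥(maximalRealSubfield L)) L (IsCMField.complexConj L) 2 1 e₁ (Matrix.diagonal dV) (JW (↥(maximalRealSubfield L)) L a')
              (chiSplittingLine L e₁ dV hdV hdV0 (toHeckeCharacter L lam) (isUnitary_toHeckeCharacter L lam)
                ((isOscillatorChar_toHeckeCharacter_iff lam).mpr hlam) (TW (↥(maximalRealSubfield L)) a')
                (isUnit_det_TW (↥(maximalRealSubfield L)) a') (JW (↥(maximalRealSubfield L)) L a') (JW_eq (↥(maximalRealSubfield L)) L a'))
              p Φ)
            (μW : Measure (↥(UnitaryGroup.adelic (↥(maximalRealSubfield L)) L (IsCMField.complexConj L) 1 (JW (↥(maximalRealSubfield L)) L a')) ⧸ (UnitaryGroup.toAdelic (↥(maximalRealSubfield L)) L (IsCMField.complexConj L) 1 (JW (↥(maximalRealSubfield L)) L a')).range))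
        [IsFiniteMeasure μW] [SMulInvariantMeasure ↥(UnitaryGroup.adelic (↥(maximalRealSubfield L)) L (IsCMField.complexConj L) 1 (JW (↥(maximalRealSubfield L)) L a')) (↥(UnitaryGroup.adelic (↥(maximalRealSubfield L)) L (IsCMField.complexConj L) 1 (JW (↥(maximalRealSubfield L)) L a')) ⧸ (UnitaryGroup.toAdelic (↥(maximalRealSubfield L)) L (IsCMField.complexConj L) 1 (JW (↥(maximalRealSubfield L)) L a')).range) μW]
            (φ : 𝓢((Fin n' → mixedEmbedding.mixedSpace ↥(maximalRealSubfield L)), ℂ)) (Φf : FinSB (↥(maximalRealSubfield L)) (Fin n')),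
            ∃ Φf' ∈ S, A (MemLp.toLp _ (memLp_toQuotFun_lineThetaLift L 2 H e₁ dV hdV hdV0 ιA hT lam hlam a' hρ μW
            (piSchwartzBruhatEquiv (↥(maximalRealSubfield L)) (Fin n') (φ ⊗ₜ[ℂ] Φf)) (charCM ξ) μ 2)) =
              MemLp.toLp _ (memLp_toQuotFun_lineThetaLift L 2 H e₁ dV hdV hdV0 ιA hT lam hlam a' hρ μW
            (piSchwartzBruhatEquiv (↥(maximalRealSubfield L)) (Fin n') (φ ⊗ₜ[ℂ] Φf')) (charCM ξ) μ 2)) ∧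
          (∀ (hρ : HasThetaMajorants fun
          (p : ↥(UnitaryGroup.adelic (↥(maximalRealSubfield L)) L (IsCMField.complexConj L) 2 (Matrix.diagonal dV)) × ↥(UnitaryGroup.adelic (↥(maximalRealSubfield L)) L (IsCMField.complexConj L) 1 (JW (↥(maximalRealSubfield L)) L a'))) (Φ : piSchwartzBruhat (↥(maximalRealSubfield L)) (Fin n')) =>
            pairRep (↥(maximalRealSubfield L)) L (IsCMField.complexConj L) 2 1 e₁ (Matrix.diagonal dV) (JW (↥(maximalRealSubfield L)) L a')
              (chiSplittingLine L e₁ dV hdV hdV0 (toHeckeCharacter L lam) (isUnitary_toHeckeCharacter L lam)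
                ((isOscillatorChar_toHeckeCharacter_iff lam).mpr hlam) (TW (↥(maximalRealSubfield L)) a')
                (isUnit_det_TW (↥(maximalRealSubfield L)) a') (JW (↥(maximalRealSubfield L)) L a') (JW_eq (↥(maximalRealSubfield L)) L a'))
              p Φ)
            (μW : Measure (↥(UnitaryGroup.adelic (↥(maximalRealSubfield L)) L (IsCMField.complexConj L) 1 (JW (↥(maximalRealSubfield L)) L a')) ⧸ (UnitaryGroup.toAdelic (↥(maximalRealSubfield L)) L (IsCMField.complexConj L) 1 (JW (↥(maximalRealSubfield L)) L a')).range))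
        [IsFiniteMeasure μW] [SMulInvariantMeasure ↥(UnitaryGroup.adelic (↥(maximalRealSubfield L)) L (IsCMField.complexConj L) 1 (JW (↥(maximalRealSubfield L)) L a')) (↥(UnitaryGroup.adelic (↥(maximalRealSubfield L)) L (IsCMField.complexConj L) 1 (JW (↥(maximalRealSubfield L)) L a')) ⧸ (UnitaryGroup.toAdelic (↥(maximalRealSubfield L)) L (IsCMField.complexConj L) 1 (JW (↥(maximalRealSubfield L)) L a')).range) μW]
            (φ : 𝓢((Fin n' → mixedEmbedding.mixedSpace ↥(maximalRealSubfield L)), ℂ)) (Φf : FinSB (↥(maximalRealSubfield L)) (Fin n')), Φf ∈ S →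
            A (MemLp.toLp _ (memLp_toQuotFun_lineThetaLift L 2 H e₁ dV hdV hdV0 ιA hT lam hlam a' hρ μW
            (piSchwartzBruhatEquiv (↥(maximalRealSubfield L)) (Fin n') (φ ⊗ₜ[ℂ] Φf)) (charCM ξ) μ 2)) =
              MemLp.toLp _ (memLp_toQuotFun_lineThetaLift L 2 H e₁ dV hdV hdV0 ιA hT lam hlam a' hρ μW
            (piSchwartzBruhatEquiv (↥(maximalRealSubfield L)) (Fin n') (φ ⊗ₜ[ℂ] Φf)) (charCM ξ) μ 2)) ∧
          (∀ (hρ : HasThetaMajorants fun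
          (p : ↥(UnitaryGroup.adelic (↥(maximalRealSubfield L)) L (IsCMField.complexConj L) 2 (Matrix.diagonal dV)) × ↥(UnitaryGroup.adelic (↥(maximalRealSubfield L)) L (IsCMField.complexConj L) 1 (JW (↥(maximalRealSubfield L)) L a'))) (Φ : piSchwartzBruhat (↥(maximalRealSubfield L)) (Fin n')) =>
            pairRep (↥(maximalRealSubfield L)) L (IsCMField.complexConj L) 2 1 e₁ (Matrix.diagonal dV) (JW (↥(maximalRealSubfield L)) L a')
              (chiSplittingLine L e₁ dV hdV hdV0 (toHeckeCharacter L lam) (isUnitary_toHeckeCharacter L lam)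
                ((isOscillatorChar_toHeckeCharacter_iff lam).mpr hlam) (TW (↥(maximalRealSubfield L)) a')
                (isUnit_det_TW (↥(maximalRealSubfield L)) a') (JW (↥(maximalRealSubfield L)) L a') (JW_eq (↥(maximalRealSubfield L)) L a'))
              p Φ)
            (μW : Measure (↥(UnitaryGroup.adelic (↥(maximalRealSubfield L)) L (IsCMField.complexConj L) 1 (JW (↥(maximalRealSubfield L)) L a')) ⧸ (UnitaryGroup.toAdelic (↥(maximalRealSubfield L)) L (IsCMField.complexConj L) 1 (JW (↥(maximalRealSubfield L)) L a')).range))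
        [IsFiniteMeasure μW] [SMulInvariantMeasure ↥(UnitaryGroup.adelic (↥(maximalRealSubfield L)) L (IsCMField.complexConj L) 1 (JW (↥(maximalRealSubfield L)) L a')) (↥(UnitaryGroup.adelic (↥(maximalRealSubfield L)) L (IsCMField.complexConj L) 1 (JW (↥(maximalRealSubfield L)) L a')) ⧸ (UnitaryGroup.toAdelic (↥(maximalRealSubfield L)) L (IsCMField.complexConj L) 1 (JW (↥(maximalRealSubfield L)) L a')).range) μW]
            (β : ((Fin n' × {v : InfinitePlace (↥(maximalRealSubfield L)) // v.IsReal}) →₀ ℕ)),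
            FiniteDimensional ℂ ↥(Submodule.span ℂ {v : ((adelicGroupData (↥(maximalRealSubfield L)) L (IsCMField.complexConj L) 2 H).L2 μ) | ∃ Φf : FinSB (↥(maximalRealSubfield L)) (Fin n'), Φf ∈ S ∧
              v = MemLp.toLp _ (memLp_toQuotFun_lineThetaLift L 2 H e₁ dV hdV hdV0 ιA hT lam hlam a' hρ μW
            (piSchwartzBruhatEquiv (↥(maximalRealSubfield L)) (Fin n') (follandHermite (frameV L e₁ dV hdV hdV0 (lineW L (TW (Fp L) a')) (complexConj_lineW L (TW (Fp L) a'))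
                (lineW_ne_zero L (TW (Fp L) a') (isUnit_det_TW (Fp L) a'))) β ⊗ₜ[ℂ] Φf)) (charCM ξ) μ 2)}))

/-- **(Gβ-M) `MeasureScaling`** — theta classes taken with two finite `U(W)(𝔸)`-invariant measures `μ_W, μ_W′` on the compact abelian quotient
`[U(⟨J_W a′⟩)]` are PROPORTIONAL, one scalar for all `Ψ`, as soon as some `μ_W`-class is non-zero (then `μ_W ≠ 0` charges every open set, so
`μ_W′ = c • μ_W` by ★ `UnitaryDualPair.smulInvariantMeasure_quotient_range_toAdelic_unique`, and the theta lift is homogeneous of degree one in the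
measure, ★ `ThetaKernelDatum.thetaLift_smul_measure`). (locator, not a cited fact: GetzHahn2024, Thm. 3.2.2) (locator, not a cited fact: FleigEtAl2018, §12.3 Def. 12.5 (12.37)) -/
def MeasureScaling : Prop :=
  ∀ (L : Type) [Field L] [NumberField L] [IsCMField L] (ι : L →+* ℂ) (H : Matrix (Fin 2) (Fin 2) L)
      (dV : Fin 2 → L) (hdV : ∀ i, IsCMField.complexConj L (dV i) = dV i) (hdV0 : ∀ i, dV i ≠ 0)
      (t : L) (ht : t ≠ 0) (g : GL (Fin 2) L)
      (hg : formCongr ((IsCMField.complexConj L : L ≃ₐ[↥(maximalRealSubfield L)] L) : L →+* L) g (t • H) = Matrix.diagonal dV),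
      (∃ T : GL (Fin 2) ℂ, formCongr (starRingEnd ℂ) T ((Matrix.diagonal dV).map ι) = Matrix.diagonal ![(1 : ℂ), -1]) →
      ∀ (hdef : ∀ τ' : L →+* ℂ, InfinitePlace.mk τ' ≠ InfinitePlace.mk ι → ((Matrix.diagonal dV).map τ').PosDef)
        (hdeg : 4 ≤ Module.finrank ℚ L)
        (μ : Measure (adelicGroupData (↥(maximalRealSubfield L)) L (IsCMField.complexConj L) 2 H).automorphicQuotient)
        [(adelicGroupData (↥(maximalRealSubfield L)) L (IsCMField.complexConj L) 2 H).IsAutomorphicMeasure μ]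
        {n' : ℕ} (e₁ : Fin 2 × Fin 1 ≃ Fin n')
        (lam : Literature.NumberTheory.Automorphic.IdeleClassGroup L →ₜ* Circle) (hlam : IsConjugateSymplectic L lam), HasWeight L lam 1 →
      ∀ (ιA : (adelicGroupData (↥(maximalRealSubfield L)) L (IsCMField.complexConj L) 2 H).Adelic →*
          ↥(UnitaryGroup.adelic (↥(maximalRealSubfield L)) L (IsCMField.complexConj L) 2 (Matrix.diagonal dV)))
        (hιA : ∀ k, ((ιA k : ↥(UnitaryGroup.adelic (↥(maximalRealSubfield L)) L (IsCMField.complexConj L) 2 (Matrix.diagonal dV))) :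
              GL (Fin 2) (AdeleRing (𝓞 L) L)) =
            (toAdeleGL L g)⁻¹ * adelicVal (↥(maximalRealSubfield L)) L (IsCMField.complexConj L) 2 H k * toAdeleGL L g)
        [CompactSpace (↥(UnitaryGroup.adelic (↥(maximalRealSubfield L)) L (IsCMField.complexConj L) 2 (Matrix.diagonal dV)) ⧸
          (UnitaryGroup.toAdelic (↥(maximalRealSubfield L)) L (IsCMField.complexConj L) 2 (Matrix.diagonal dV)).range)]
        (a' : (↥(maximalRealSubfield L))ˣ)
        (ξ : haveI := normal_range_toAdelic_JW L a'
          PontryaginDual (↥(UnitaryGroup.adelic (↥(maximalRealSubfield L)) L (IsCMField.complexConj L) 1 (JW (↥(maximalRealSubfield L)) L a')) ⧸ (UnitaryGroup.toAdelic (↥(maximalRealSubfield L)) L (IsCMField.complexConj L) 1 (JW (↥(maximalRealSubfield L)) L a')).range)),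
        letI : MeasurableSpace (↥(UnitaryGroup.adelic (↥(maximalRealSubfield L)) L (IsCMField.complexConj L) 1 (JW (↥(maximalRealSubfield L)) L a')) ⧸ (UnitaryGroup.toAdelic (↥(maximalRealSubfield L)) L (IsCMField.complexConj L) 1 (JW (↥(maximalRealSubfield L)) L a')).range) := borel _
        haveI := normal_range_toAdelic_JW L a'
        haveI : CompactSpace (adelicGroupData (↥(maximalRealSubfield L)) L (IsCMField.complexConj L) 2 H).automorphicQuotient :=
          (UnitaryGroup.exists_infinitePlace_ne L hdeg ι).elim fun τ hτ =>
            UnitaryGroup.compactSpace_adelicGroupData_automorphicQuotient L 2 H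
              (UnitaryGroup.anisotropic_of_formCongr_smul_eq_of_posDef L 2 H dV t ht g hg τ (hdef τ hτ))
        haveI hT : Continuous ιA ∧ ∀ ⦃γ : (adelicGroupData (↥(maximalRealSubfield L)) L (IsCMField.complexConj L) 2 H).Adelic⦄,
            γ ∈ (UnitaryGroup.toAdelic (↥(maximalRealSubfield L)) L (IsCMField.complexConj L) 2 H).range →
              ιA γ ∈ (UnitaryGroup.toAdelic (↥(maximalRealSubfield L)) L (IsCMField.complexConj L) 2 (Matrix.diagonal dV)).range :=
          ⟨continuous_of_pin L 2 H dV g ιA hιA, fun _ hγ => mem_range_toAdelic_of_pin L 2 H dV t ht g hg ιA hιA hγ⟩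
        ∀ (hρ : HasThetaMajorants fun
          (p : ↥(UnitaryGroup.adelic (↥(maximalRealSubfield L)) L (IsCMField.complexConj L) 2 (Matrix.diagonal dV)) × ↥(UnitaryGroup.adelic (↥(maximalRealSubfield L)) L (IsCMField.complexConj L) 1 (JW (↥(maximalRealSubfield L)) L a'))) (Φ : piSchwartzBruhat (↥(maximalRealSubfield L)) (Fin n')) =>
            pairRep (↥(maximalRealSubfield L)) L (IsCMField.complexConj L) 2 1 e₁ (Matrix.diagonal dV) (JW (↥(maximalRealSubfield L)) L a')
              (chiSplittingLine L e₁ dV hdV hdV0 (toHeckeCharacter L lam) (isUnitary_toHeckeCharacter L lam)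
                ((isOscillatorChar_toHeckeCharacter_iff lam).mpr hlam) (TW (↥(maximalRealSubfield L)) a')
                (isUnit_det_TW (↥(maximalRealSubfield L)) a') (JW (↥(maximalRealSubfield L)) L a') (JW_eq (↥(maximalRealSubfield L)) L a'))
              p Φ)
        (hρ' : HasThetaMajorants fun
          (p : ↥(UnitaryGroup.adelic (↥(maximalRealSubfield L)) L (IsCMField.complexConj L) 2 (Matrix.diagonal dV)) × ↥(UnitaryGroup.adelic (↥(maximalRealSubfield L)) L (IsCMField.complexConj L) 1 (JW (↥(maximalRealSubfield L)) L a'))) (Φ : piSchwartzBruhat (↥(maximalRealSubfield L)) (Fin n')) =>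
            pairRep (↥(maximalRealSubfield L)) L (IsCMField.complexConj L) 2 1 e₁ (Matrix.diagonal dV) (JW (↥(maximalRealSubfield L)) L a')
              (chiSplittingLine L e₁ dV hdV hdV0 (toHeckeCharacter L lam) (isUnitary_toHeckeCharacter L lam)
                ((isOscillatorChar_toHeckeCharacter_iff lam).mpr hlam) (TW (↥(maximalRealSubfield L)) a')
                (isUnit_det_TW (↥(maximalRealSubfield L)) a') (JW (↥(maximalRealSubfield L)) L a') (JW_eq (↥(maximalRealSubfield L)) L a'))
              p Φ)
        (μW : Measure (↥(UnitaryGroup.adelic (↥(maximalRealSubfield L)) L (IsCMField.complexConj L) 1 (JW (↥(maximalRealSubfield L)) L a')) ⧸ (UnitaryGroup.toAdelic (↥(maximalRealSubfield L)) L (IsCMField.complexConj L) 1 (JW (↥(maximalRealSubfield L)) L a')).range))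
        [IsFiniteMeasure μW] [SMulInvariantMeasure ↥(UnitaryGroup.adelic (↥(maximalRealSubfield L)) L (IsCMField.complexConj L) 1 (JW (↥(maximalRealSubfield L)) L a')) (↥(UnitaryGroup.adelic (↥(maximalRealSubfield L)) L (IsCMField.complexConj L) 1 (JW (↥(maximalRealSubfield L)) L a')) ⧸ (UnitaryGroup.toAdelic (↥(maximalRealSubfield L)) L (IsCMField.complexConj L) 1 (JW (↥(maximalRealSubfield L)) L a')).range) μW]
        (μW' : Measure (↥(UnitaryGroup.adelic (↥(maximalRealSubfield L)) L (IsCMField.complexConj L) 1 (JW (↥(maximalRealSubfield L)) L a')) ⧸ (UnitaryGroup.toAdelic (↥(maximalRealSubfield L)) L (IsCMField.complexConj L) 1 (JW (↥(maximalRealSubfield L)) L a')).range))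
        [IsFiniteMeasure μW'] [SMulInvariantMeasure ↥(UnitaryGroup.adelic (↥(maximalRealSubfield L)) L (IsCMField.complexConj L) 1 (JW (↥(maximalRealSubfield L)) L a')) (↥(UnitaryGroup.adelic (↥(maximalRealSubfield L)) L (IsCMField.complexConj L) 1 (JW (↥(maximalRealSubfield L)) L a')) ⧸ (UnitaryGroup.toAdelic (↥(maximalRealSubfield L)) L (IsCMField.complexConj L) 1 (JW (↥(maximalRealSubfield L)) L a')).range) μW'],
        (∃ Ψ₀ : piSchwartzBruhat (↥(maximalRealSubfield L)) (Fin n'), MemLp.toLp _ (memLp_toQuotFun_lineThetaLift L 2 H e₁ dV hdV hdV0 ιA hT lam hlam a' hρ μW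
            (Ψ₀) (charCM ξ) μ 2) ≠ 0) →
          ∃ c : ℂ, ∀ Ψ : piSchwartzBruhat (↥(maximalRealSubfield L)) (Fin n'),
            MemLp.toLp _ (memLp_toQuotFun_lineThetaLift L 2 H e₁ dV hdV hdV0 ιA hT lam hlam a' hρ' μW'
            (Ψ) (charCM ξ) μ 2) =
              c • MemLp.toLp _ (memLp_toQuotFun_lineThetaLift L 2 H e₁ dV hdV hdV0 ιA hT lam hlam a' hρ μW
            (Ψ) (charCM ξ) μ 2)



end Summit.HodgeConjecture.HodgeConjecture.Cruxes.HLiu418.F0LD1ThetaSliceOfBricks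

end
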